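import Summits.CriticalPhenomena.PercolationContinuityZ3.Theorems.Transplant.SharpnessGridFinal
import Summits.CriticalPhenomena.PercolationContinuityZ3.Theorems.Transplant.SharpnessSubdividedLattice
import Summits.CriticalPhenomena.PercolationContinuityZ3.Theorems.Transplant.SharpnessGridFinalSharp
import HarnessLib

/-!
# One ambient lattice, two nested graphs: continuity at `p_c` flips exactly with quasi-transitivity

House module of the `TransplantSharpness` programme (sharpness desk, rows 83 + 84 in one sentence).  Inside `ℤ²`, for
`b > 2a > 0` and every large even mesh `M`, the two induced subgraphs

* `ℤ²[L_M]` (the `M`-subdivided square lattice, row 84): quasi-transitive, `p_c = 2^{-1/M}`, `θ(p_c) = 0`;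
* `G′_M = ℤ²[W ∪ L_M] ⊇ ℤ²[L_M]` (the gridded logarithmic wedge, row 83): NOT quasi-transitive, `p_c(G′_M) = p_c(W)`
  STRICTLY smaller, `θ(p_c) > 0`,

differ by the density-zero wedge `W` only; both are planar, amenable, of quadratic growth, rough-isometric to `ℤ²`.
So within this pair the quasi-transitivity hypothesis of the Benjamini–Schramm continuity conjecture is exactly what
separates continuity from a first-order transition (`nested_pair_continuity_iff_quasiTransitive`).
-/

noncomputable section

namespace Summit.CriticalPhenomena.PercolationContinuityZ3.Theorems.TransplantSharpness

open MeasureTheory Literature.Probability.Percolation Literature.Probability.LatticeModels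
open Literature.Barriers.CriticalPhenomena (IsQuasiTransitive logWedgeGraph logWedgeOrigin)

/-- **Rows 83 + 84**: for `b > 2a > 0` and all large even `M`, the nested induced subgraphs `ℤ²[L_M] ⊆ ℤ²[W ∪ L_M]` of `ℤ²`
satisfy: `ℤ²[L_M]` is quasi-transitive with `p_c = (1/2)^{1/M}` and `θ(p_c) = 0`, while `ℤ²[W ∪ L_M]` is not
quasi-transitive, has the strictly smaller critical point `p_c(W)`, and `θ(p_c) > 0`. [folklore] -/
theorem nested_pair_continuity_iff_quasiTransitive {a b : ℝ} (ha : 0 < a) (hab : 2 * a < b) :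
    ∃ M₀ : ℕ, ∀ M : ℕ, M₀ ≤ M → 2 ∣ M →
      gridLines M ⊆ gridWedge a b M ∧
      (IsQuasiTransitive ((zdGraph 2).induce (gridLines M)) ∧
        criticalProb ((zdGraph 2).induce (gridLines M)) ⟨0, zero_mem_gridLines M⟩ = (1 / 2 : ℝ) ^ ((1 : ℝ) / M) ∧
        theta ((zdGraph 2).induce (gridLines M)) ⟨0, zero_mem_gridLines M⟩
          ⟨criticalProb ((zdGraph 2).induce (gridLines M)) ⟨0, zero_mem_gridLines M⟩, criticalProb_mem_Icc _ _⟩ = 0) ∧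
      (¬ IsQuasiTransitive (gridWedgeGraph a b M) ∧
        criticalProb (gridWedgeGraph a b M) (gridWedgeOrigin a b M) =
          criticalProb (logWedgeGraph a b) (logWedgeOrigin a b) ∧
        criticalProb (gridWedgeGraph a b M) (gridWedgeOrigin a b M) <
          criticalProb ((zdGraph 2).induce (gridLines M)) ⟨0, zero_mem_gridLines M⟩ ∧
        0 < theta (gridWedgeGraph a b M) (gridWedgeOrigin a b M)
          ⟨criticalProb (gridWedgeGraph a b M) (gridWedgeOrigin a b M), criticalProb_mem_Icc _ _⟩) := by
  obtain ⟨M₁, h₁⟩ := gridWedge_percolates_at_own_criticalProb_eventually ha hab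
  obtain ⟨M₂, h₂⟩ := criticalProb_gridWedge_lt_subdividedLattice_eventually ha hab
  refine ⟨max (max M₁ M₂) 1, fun M hM hMe => ?_⟩
  have hM₁ : M₁ ≤ M := le_trans (le_trans (le_max_left _ _) (le_max_left _ _)) hM
  have hM₂ : M₂ ≤ M := le_trans (le_trans (le_max_right _ _) (le_max_left _ _)) hM
  have hM1 : 1 ≤ M := le_trans (le_max_right _ _) hM
  obtain ⟨hnqt, hpc, -, -, hθ⟩ := h₁ M hM₁ hMe
  exact ⟨gridLines_subset_gridWedge a b M,
    ⟨subdividedLattice_isQuasiTransitive hM1, criticalProb_subdividedLattice_eq hM1,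
      theta_subdividedLattice_criticalProb_eq_zero hM1⟩,
    ⟨hnqt, hpc, h₂ M hM₂, hθ⟩⟩

/-- **Rows 83 + 84 for EVERY even mesh** (sharpness edition): for `b > 2a > 0` and every even `M ≥ 2`, the nested induced
subgraphs `ℤ²[L_M] ⊆ ℤ²[W ∪ L_M]` of `ℤ²` satisfy: `ℤ²[L_M]` is quasi-transitive with `p_c = 2^{-1/M}` and `θ(p_c) = 0`;
`ℤ²[W ∪ L_M]` is not quasi-transitive with `p_c = min(p_c(W), 2^{-1/M}) ≤ p_c(ℤ²[L_M])`, and whenever the wedge drives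
(`p_c(W) ≤ 2^{-1/M}`, i.e. for all `M ≥ M*(a,b)`) it percolates at its critical point. [folklore] -/
theorem nested_pair_all_even {a b : ℝ} (ha : 0 < a) (hab : 2 * a < b) {M : ℕ} (hM : 2 ≤ M) (hMe : 2 ∣ M) :
    gridLines M ⊆ gridWedge a b M ∧
    (IsQuasiTransitive ((zdGraph 2).induce (gridLines M)) ∧
      criticalProb ((zdGraph 2).induce (gridLines M)) ⟨0, zero_mem_gridLines M⟩ = (1 / 2 : ℝ) ^ ((1 : ℝ) / M) ∧
      theta ((zdGraph 2).induce (gridLines M)) ⟨0, zero_mem_gridLines M⟩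
        ⟨criticalProb ((zdGraph 2).induce (gridLines M)) ⟨0, zero_mem_gridLines M⟩, criticalProb_mem_Icc _ _⟩ = 0) ∧
    (¬ IsQuasiTransitive (gridWedgeGraph a b M) ∧
      criticalProb (gridWedgeGraph a b M) (gridWedgeOrigin a b M) =
        min (criticalProb (logWedgeGraph a b) (logWedgeOrigin a b)) ((1 / 2 : ℝ) ^ ((1 : ℝ) / M)) ∧
      criticalProb (gridWedgeGraph a b M) (gridWedgeOrigin a b M) ≤
        criticalProb ((zdGraph 2).induce (gridLines M)) ⟨0, zero_mem_gridLines M⟩ ∧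
      (criticalProb (logWedgeGraph a b) (logWedgeOrigin a b) ≤ (1 / 2 : ℝ) ^ ((1 : ℝ) / M) →
        0 < theta (gridWedgeGraph a b M) (gridWedgeOrigin a b M)
          ⟨criticalProb (gridWedgeGraph a b M) (gridWedgeOrigin a b M), criticalProb_mem_Icc _ _⟩)) := by
  have hM1 : 1 ≤ M := by omega
  refine ⟨gridLines_subset_gridWedge a b M,
    ⟨subdividedLattice_isQuasiTransitive hM1, criticalProb_subdividedLattice_eq hM1,
      theta_subdividedLattice_criticalProb_eq_zero hM1⟩,
    ⟨not_isQuasiTransitive_gridWedgeGraph ha (by linarith) hM, criticalProb_gridWedge_eq_min ha hab hM hMe, ?_, fun hreg => ?_⟩⟩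
  · rw [criticalProb_subdividedLattice_eq hM1]; exact criticalProb_gridWedge_le_rpow a b hM1
  · exact (gridWedge_percolates_at_own_criticalProb_of_wedge_le ha hab hM hMe hreg).2.2.2.2

end Summit.CriticalPhenomena.PercolationContinuityZ3.Theorems.TransplantSharpness
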